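import Summits.Ventures.PercRepro.ThetaOmegaGraphPacking

/-!
# The graph form of (Ω): the triangle (hitting-set) form

Addendum 85 (mine-1, gen 46). A symmetric graph of independence number ≤ 2 on the slots of `F`
is the same thing as a family `M` of marked sets such that every three distinct slots have a
pairwise meet in `M` (take `Γ u v := slotMeet U u v ∈ M`; conversely take `M` = the counted sets).
So the conjecture (Ω_Γ) says exactly:

* `OmegaHitting α` — **the triangle form**: for every family `F` of at least three subsets of a
  ground set `U` and every family `M` of FEWER than `|F|` marked sets, some three distinct slots
  of `F` have all three pairwise meets outside `M` — i.e. the minimum hitting set of the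
  3-uniform(≤) hypergraph of meet-sets of slot triples has at least `|F|` elements;
* `omegaHitting_of_omegaGraphSymm` / `omegaGraphSymm_of_omegaHitting` — the two forms are
  equivalent (`omegaGraphSymm_iff_omegaHitting`).

The triangle form is the one the packing bound (`card_le_omegaCountG_of_packing`) certifies:
`|F|` slot triples with pairwise disjoint meet-sets leave, for every `M` of fewer than `|F|`
sets, a triple untouched by `M`.
-/

namespace PercRepro.MSTight

open Finset

variable {α : Type*} [DecidableEq α]

section SlotMeetComm

/-- The slot meet is symmetric. -/
theorem slotMeet_comm (U : Finset α) (u v : Slot α) : slotMeet U u v = slotMeet U v u := by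
  obtain ⟨s, b⟩ := u
  obtain ⟨t, c⟩ := v
  cases b <;> cases c
  · show (s ⊓ t, false) = (t ⊓ s, false)
    rw [inf_comm]
  · rfl
  · rfl
  · show (U \ (s ⊔ t), true) = (U \ (t ⊔ s), true)
    rw [sup_comm]

variable {Γ : Slot α → Slot α → Prop} [DecidableRel Γ] {U : Finset α} {F : Finset (Finset α)}

/-- Every counted marked set is the meet of two distinct related slots of `F`. -/
theorem exists_of_mem_omegaSetG {x : Finset α × Bool} (hx : x ∈ omegaSetG Γ U F) :
    ∃ u v : Slot α, u.1 ∈ F ∧ v.1 ∈ F ∧ u ≠ v ∧ Γ u v ∧ slotMeet U u v = x := by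
  unfold omegaSetG at hx
  simp only [mem_union, mem_map, Function.Embedding.coeFn_mk] at hx
  rcases hx with ⟨E, hE, rfl⟩ | ⟨E, hE, rfl⟩
  · rcases mem_omegaAR.1 hE with ⟨s, hs, t, ht, hst, hr, rfl⟩ | ⟨s, hs, t, ht, hr, rfl⟩
    · exact ⟨topSlot s, topSlot t, hs, ht, fun h => hst (topSlot_injective h), hr, rfl⟩
    · exact ⟨topSlot s, botSlot t, hs, ht, topSlot_ne_botSlot s t, hr, rfl⟩
  · obtain ⟨s, hs, t, ht, hst, hr, rfl⟩ := mem_omegaCR.1 hE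
    exact ⟨botSlot s, botSlot t, hs, ht, fun h => hst (botSlot_injective h), hr, rfl⟩

end SlotMeetComm

section Hitting

/-- **The triangle form of (Ω_Γ)**: for every family of at least three subsets of a ground set and
every family `M` of fewer than `|F|` marked sets, some three distinct slots of `F` have all three
pairwise slot meets outside `M`. -/
def OmegaHitting (α : Type*) [DecidableEq α] : Prop :=
  ∀ (U : Finset α) (F : Finset (Finset α)) (M : Finset (Finset α × Bool)),
    (∀ s ∈ F, s ⊆ U) → 3 ≤ F.card → M.card < F.card →
      ∃ u v w : Slot α, u.1 ∈ F ∧ v.1 ∈ F ∧ w.1 ∈ F ∧ u ≠ v ∧ u ≠ w ∧ v ≠ w ∧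
        slotMeet U u v ∉ M ∧ slotMeet U u w ∉ M ∧ slotMeet U v w ∉ M

/-- **The graph form implies the triangle form**: if every three distinct slots had a pairwise
meet in `M`, the graph «the meet lies in `M`» would be a symmetric graph of independence number
at most two whose counted sets all lie in `M`. -/
theorem omegaHitting_of_omegaGraphSymm (hG : OmegaGraphSymm α) : OmegaHitting α := by
  intro U F M hF h3 hM
  by_contra hno
  simp only [not_exists, not_and, not_not] at hno
  -- the graph «the meet lies in `M`»
  let Γ : Slot α → Slot α → Prop := fun u v => slotMeet U u v ∈ M
  have hsym : ∀ u v, Γ u v → Γ v u := fun u v h => by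
    show slotMeet U v u ∈ M
    rw [slotMeet_comm]
    exact h
  have hT : SlotTripleRel Γ F := by
    intro u v w hu hv hw huv huw hvw
    by_cases h1 : slotMeet U u v ∈ M
    · exact Or.inl h1
    by_cases h2 : slotMeet U u w ∈ M
    · exact Or.inr (Or.inr (Or.inl h2))
    exact Or.inr (Or.inr (Or.inr (Or.inr (Or.inl (hno u v w hu hv hw huv huw hvw h1 h2)))))
  have hcount := hG U F Γ hsym hF h3 hT
  have hsub : omegaSetG Γ U F ⊆ M := by
    intro x hx
    obtain ⟨u, v, _, _, _, hr, rfl⟩ := exists_of_mem_omegaSetG hx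
    exact hr
  have := card_le_card hsub
  rw [card_omegaSetG] at this
  omega

/-- **The triangle form implies the graph form**: the counted sets of a symmetric graph of
independence number at most two form a family `M` hitting every triple. -/
theorem omegaGraphSymm_of_omegaHitting (hH : OmegaHitting α) : OmegaGraphSymm α := by
  intro U F Γ _ hsym hF h3 hT
  by_contra hlt
  have hlt' : omegaCountG Γ U F < F.card := lt_of_not_ge hlt
  rw [← card_omegaSetG] at hlt'
  obtain ⟨u, v, w, hu, hv, hw, huv, huw, hvw, h1, h2, h3'⟩ := hH U F _ hF h3 hlt'
  rcases hT u v w hu hv hw huv huw hvw with h | h | h | h | h | h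
  · exact h1 (slotMeet_mem_omegaSetG hsym hu hv huv h)
  · exact h1 (by rw [slotMeet_comm]; exact slotMeet_mem_omegaSetG hsym hv hu huv.symm h)
  · exact h2 (slotMeet_mem_omegaSetG hsym hu hw huw h)
  · exact h2 (by rw [slotMeet_comm]; exact slotMeet_mem_omegaSetG hsym hw hu huw.symm h)
  · exact h3' (slotMeet_mem_omegaSetG hsym hv hw hvw h)
  · exact h3' (by rw [slotMeet_comm]; exact slotMeet_mem_omegaSetG hsym hw hv hvw.symm h)

/-- **(Ω_Γ) and its triangle form are the same statement.** -/
theorem omegaGraphSymm_iff_omegaHitting : OmegaGraphSymm α ↔ OmegaHitting α :=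
  ⟨omegaHitting_of_omegaGraphSymm, omegaGraphSymm_of_omegaHitting⟩

end Hitting

end PercRepro.MSTight
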